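import Mathlib
import HarnessLib
import Summits.HubbardSuperconductivity.HubbardSuperconductivity.Theorems.KLProgrammeC4aPPKernelFamily
import Summits.HubbardSuperconductivity.HubbardSuperconductivity.Theorems.KLProgrammeC4aPPKernelOneSidedRows

/-!
# Route `KLProgramme` — crux C4a, S3 brick (B4) «(B4)-UMK1», «(M1)-FAMILY» part 3: the family at a POSITIVE loop level with the partner FAR BELOW the Fermi
# level (`u ≤ −e(1−t₁)/t₁`, the only region where `Kr ≠ K⁺`) — the branch `F(u) = N(e,u)·R₋(u)`, `R₋(u) = κ(e/(e−u))/(e+u)`, to second order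

Cell `gate-hubbard-kl`, seat hubbard-kl-k3c3-p1 (g16; row «δμ-flow with klAngularMean constant piece»).  Located brick for the (C)-closer lane's `foldBox_law_rows`
rows `hK2d/hK2` on `e ∈ [lo,hi]` for the ONE family `Kr = ppFamilyKernel` of part 1 (stmt-HubbardSuperconductivity-20437 (C)/(U1)); part 4 = `…C4aPPKernelFamilySecond`
(the rows); memo HOME/hubbard-kl-k3c3-p1/g16-M1-NEG-PRE-KERNEL.md §7.

WHY.  For `e > 0` the family `P(e,u)·κ(e/(e+|u|))` coincides with the one-sided kernel `K⁺` on `u > −e(1−t₁)/t₁` (both vanish on `|u| ≤ e(1−t₁)/t₁`, both are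
`P·κ(e/(e+u))` on `u > 0`); it differs only on `u < −e(1−t₁)/t₁ ≤ −3e/2` (`t₁ ≤ 2/5`), where the loop line is the finer one and the partner sits below the Fermi level —
a region reached on POST-side angles, so a genuine partition piece must carry it.  There `e + u ≤ −e/2 < 0`, `P = N/(e+u)`, `|e+u| ≥ |u|/3`, and `|u| = max(e,|u|)`,
so the (N2)-grade envelopes hold with the signed `N`-sizes of `…TrueSignedDeriv` (`|∂ᵤN| ≤ (6B₁+9/2)/|u|`, `|∂ᵤ²N| ≤ (16B₂+24B₁+33)/u²`) and the `R₋`-calculus below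
(`a(u) = e/(e−u)`, `|a′| ≤ 1/|u|`, `|a″| ≤ 2/u²`, `|1/(e+u)| ≤ 3/|u|`).
* §1 `hasDerivAt_belowRatio` (`a′ = e/(e−u)²`), **`hasDerivAt_belowR`**, **`hasDerivAt_belowR1`** (`R₋′ = κ′(a)a′b − κ(a)b²`, `R₋″ = κ″(a)a′²b + κ′(a)a″b − 2κ′(a)a′b² + 2κ(a)b³`,
  `b = 1/(e+u)`, written out), sizes **`abs_belowR_le`** `3κ₀/|u|`, **`abs_belowR1_le`** `(3κ₁+9κ₀)/u²`, **`abs_belowR2_le`** `(3κ₂+24κ₁+54κ₀)/|u|³` for `e(1−t₁)/t₁ ≤ −u`,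
  `t₁ ≤ 2/5`;
* §2 **`ppFamilyKernel_eq_below`** (`u < 0 ⟹ Kr(e,u) = N(e,u)·R₋(u)` wherever `e + u ≠ 0`), **`hasDerivAt_below`/`hasDerivAt_below1`** for `F = N·R₋` on `u < −5e/4`, the bounds
  **`abs_below1_le`** (`|F′| ≤ C₁₋/u²`) and **`abs_below2_le`** (`|F″| ≤ C₂₋/|u|³`, `C₂₋ = 3κ₀(16B₂+24B₁+33) + 2(6B₁+9/2)(3κ₁+9κ₀) + 3κ₂+24κ₁+54κ₀`) on `−u ≥ e(1−t₁)/t₁`,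
  and `below2_eq_zero`/vanishing on `5e/4 < −u < e(1−t₁)/t₁`.
Pure real analysis on Literature objects; nothing asserts (C), K3, the window or superconductivity.
References: BGM 2006 §2.4 (2.36) [cite: BenfattoGiulianiMastropietro2006]; Salmhofer 1999 §4.2.5 (4.70)–(4.71) [cite: Salmhofer1999].
-/

noncomputable section

namespace Summit.HubbardSuperconductivity.HubbardSuperconductivity.Theorems.C4a

set_option linter.dupNamespace false -- summit = problem name (single-conjunct summit), D-0017

open Real Filter Set
open scoped Topology
open Literature.MathematicalPhysics.QuantumLattice Literature.Analysis.SpecialFunctions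

/-! ## §1 The below-branch split factor `R₋(u) = κ(e/(e−u))/(e+u)` to second order -/

/-- `d/du [e/(e−u)] = e/(e−u)²` (`e − u ≠ 0`). [folklore] -/
theorem hasDerivAt_belowRatio {e u : ℝ} (hs : e - u ≠ 0) : HasDerivAt (fun v : ℝ => e / (e - v)) (e / (e - u) ^ 2) u := by
  have h1 : HasDerivAt (fun v : ℝ => e - v) (-1) u := by simpa using (hasDerivAt_id u).const_sub e
  have h2 := (hasDerivAt_const u e).div h1 hs
  refine h2.congr_deriv ?_
  field_simp
  ring

/-- **`∂ᵤR₋`**: `R₋′ = κ′(a)·(e/(e−u)²)/(e+u) − κ(a)/(e+u)²`, `a = e/(e−u)` (`e − u ≠ 0`, `e + u ≠ 0`). [folklore] -/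
theorem hasDerivAt_belowR {κ κ' : ℝ → ℝ} (hκ : ∀ t, HasDerivAt κ (κ' t) t) {e u : ℝ} (hm : e - u ≠ 0) (hp : e + u ≠ 0) :
    HasDerivAt (fun v : ℝ => κ (e / (e - v)) / (e + v))
      (κ' (e / (e - u)) * (e / (e - u) ^ 2) / (e + u) - κ (e / (e - u)) / (e + u) ^ 2) u := by
  have ha := hasDerivAt_belowRatio hm
  have hκa : HasDerivAt (fun v : ℝ => κ (e / (e - v))) (κ' (e / (e - u)) * (e / (e - u) ^ 2)) u := (hκ _).comp u ha
  have h1 : HasDerivAt (fun v : ℝ => e + v) 1 u := (hasDerivAt_id u).const_add e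
  have h := hκa.div h1 hp
  refine h.congr_deriv ?_
  field_simp

/-- **`∂ᵤR₋′`**: the second derivative of `R₋`, written out (`e − u ≠ 0`, `e + u ≠ 0`). [folklore] -/
theorem hasDerivAt_belowR1 {κ κ' κ'' : ℝ → ℝ} (hκ : ∀ t, HasDerivAt κ (κ' t) t) (hκ' : ∀ t, HasDerivAt κ' (κ'' t) t) {e u : ℝ} (hm : e - u ≠ 0)
    (hp : e + u ≠ 0) :
    HasDerivAt (fun v : ℝ => κ' (e / (e - v)) * (e / (e - v) ^ 2) / (e + v) - κ (e / (e - v)) / (e + v) ^ 2)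
      (κ'' (e / (e - u)) * (e / (e - u) ^ 2) ^ 2 / (e + u) + κ' (e / (e - u)) * (2 * e / (e - u) ^ 3) / (e + u) -
        2 * (κ' (e / (e - u)) * (e / (e - u) ^ 2)) / (e + u) ^ 2 + 2 * κ (e / (e - u)) / (e + u) ^ 3) u := by
  have ha := hasDerivAt_belowRatio hm
  have hκa : HasDerivAt (fun v : ℝ => κ (e / (e - v))) (κ' (e / (e - u)) * (e / (e - u) ^ 2)) u := (hκ _).comp u ha
  have hκ'a : HasDerivAt (fun v : ℝ => κ' (e / (e - v))) (κ'' (e / (e - u)) * (e / (e - u) ^ 2)) u := (hκ' _).comp u ha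
  have ha' : HasDerivAt (fun v : ℝ => e / (e - v) ^ 2) (2 * e / (e - u) ^ 3) u := by
    have h1 : HasDerivAt (fun v : ℝ => (e - v) ^ 2) (2 * (e - u) * (-1)) u := by
      have h := ((hasDerivAt_id u).const_sub e).pow 2
      refine h.congr_deriv ?_
      simp
    have h2 := (hasDerivAt_const u e).div h1 (pow_ne_zero 2 hm)
    refine h2.congr_deriv ?_
    field_simp
    ring
  have hb1 : HasDerivAt (fun v : ℝ => e + v) 1 u := (hasDerivAt_id u).const_add e
  have hb2 : HasDerivAt (fun v : ℝ => (e + v) ^ 2) (2 * (e + u)) u := by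
    have h := ((hasDerivAt_id u).const_add e).pow 2
    refine h.congr_deriv ?_
    simp
  have hT1 := (hκ'a.mul ha').div hb1 hp
  have hT2 := hκa.div hb2 (pow_ne_zero 2 hp)
  have h := hT1.sub hT2
  refine h.congr_deriv ?_
  simp only [Pi.mul_apply]
  field_simp
  ring

/-- The geometry of the far-below region: `0 < e`, `0 < t₁ ≤ 2/5`, `e(1−t₁)/t₁ ≤ −u` ⟹ `3e/2 ≤ |u|`, `|u| = −u`, `e − u = e + |u| ≥ |u|`, `−(e+u) ≥ |u|/3`,
`max e |u| = |u|`. [folklore] -/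
theorem below_geometry {t₁ e u : ℝ} (ht₀ : 0 < t₁) (ht25 : t₁ ≤ 2 / 5) (he : 0 < e) (hu : e * (1 - t₁) / t₁ ≤ -u) :
    3 / 2 * e ≤ -u ∧ |u| = -u ∧ |u| ≤ e - u ∧ |u| / 3 ≤ -(e + u) ∧ max e |u| = |u| := by
  have h32 : 3 / 2 * e ≤ e * (1 - t₁) / t₁ := by
    rw [le_div_iff₀ ht₀]; nlinarith
  have h1 : 3 / 2 * e ≤ -u := h32.trans hu
  have hu0 : u < 0 := by linarith
  have habs : |u| = -u := abs_of_neg hu0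
  refine ⟨h1, habs, by rw [habs]; linarith, by rw [habs]; linarith, ?_⟩
  rw [habs]; exact max_eq_right (by linarith)

/-- **`|R₋| ≤ 3κ₀/|u|`** on the far-below region. [folklore] -/
theorem abs_belowR_le {κ : ℝ → ℝ} {κ₀ : ℝ} (hκb : ∀ t ∈ Icc 0 1, |κ t| ≤ κ₀) {t₁ e u : ℝ} (ht₀ : 0 < t₁) (ht25 : t₁ ≤ 2 / 5) (he : 0 < e)
    (hu : e * (1 - t₁) / t₁ ≤ -u) : |κ (e / (e - u)) / (e + u)| ≤ 3 * κ₀ / |u| := by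
  obtain ⟨h1, habs, hmu, hpu, _⟩ := below_geometry ht₀ ht25 he hu
  have hu0 : 0 < |u| := by rw [habs]; linarith
  have hm0 : 0 < e - u := by linarith
  have ha : e / (e - u) ∈ Icc (0 : ℝ) 1 := ⟨div_nonneg he.le hm0.le, (div_le_one hm0).2 (by linarith)⟩
  have hκ₀ : 0 ≤ κ₀ := (abs_nonneg _).trans (hκb _ ha)
  rw [abs_div]
  have hs : |u| / 3 ≤ |e + u| := hpu.trans (neg_le_abs _)
  calc |κ (e / (e - u))| / |e + u| ≤ κ₀ / (|u| / 3) := div_le_div₀ hκ₀ (hκb _ ha) (by positivity) hs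
    _ = 3 * κ₀ / |u| := by field_simp

/-- **`|R₋′| ≤ (3κ₁ + 9κ₀)/u²`** on the far-below region. [folklore] -/
theorem abs_belowR1_le {κ κ' : ℝ → ℝ} {κ₀ κ₁ : ℝ} (hκb : ∀ t ∈ Icc 0 1, |κ t| ≤ κ₀) (hκ'b : ∀ t ∈ Icc 0 1, |κ' t| ≤ κ₁) {t₁ e u : ℝ} (ht₀ : 0 < t₁)
    (ht25 : t₁ ≤ 2 / 5) (he : 0 < e) (hu : e * (1 - t₁) / t₁ ≤ -u) :
    |κ' (e / (e - u)) * (e / (e - u) ^ 2) / (e + u) - κ (e / (e - u)) / (e + u) ^ 2| ≤ (3 * κ₁ + 9 * κ₀) / u ^ 2 := by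
  obtain ⟨h1, habs, hmu, hpu, _⟩ := below_geometry ht₀ ht25 he hu
  have hu0 : 0 < |u| := by rw [habs]; linarith
  have hm0 : 0 < e - u := by linarith
  have ha : e / (e - u) ∈ Icc (0 : ℝ) 1 := ⟨div_nonneg he.le hm0.le, (div_le_one hm0).2 (by linarith)⟩
  have hκ₀ : 0 ≤ κ₀ := (abs_nonneg _).trans (hκb _ ha)
  have hκ₁ : 0 ≤ κ₁ := (abs_nonneg _).trans (hκ'b _ ha)
  have hs : |u| / 3 ≤ |e + u| := hpu.trans (neg_le_abs _)
  have hs0 : 0 < |e + u| := lt_of_lt_of_le (by positivity) hs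
  have ha' : |e / (e - u) ^ 2| ≤ 1 / |u| := by
    rw [abs_div, abs_of_pos he, abs_of_pos (pow_pos hm0 2), div_le_div_iff₀ (pow_pos hm0 2) hu0]
    nlinarith [mul_pos he hu0]
  have hT1 : |κ' (e / (e - u)) * (e / (e - u) ^ 2) / (e + u)| ≤ 3 * κ₁ / u ^ 2 := by
    rw [abs_div, abs_mul]
    calc |κ' (e / (e - u))| * |e / (e - u) ^ 2| / |e + u| ≤ κ₁ * (1 / |u|) / (|u| / 3) :=
          div_le_div₀ (by positivity) (mul_le_mul (hκ'b _ ha) ha' (abs_nonneg _) hκ₁) (by positivity) hs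
      _ = 3 * κ₁ / |u| ^ 2 := by field_simp
      _ = 3 * κ₁ / u ^ 2 := by rw [sq_abs]
  have hT2 : |κ (e / (e - u)) / (e + u) ^ 2| ≤ 9 * κ₀ / u ^ 2 := by
    rw [abs_div, abs_pow]
    calc |κ (e / (e - u))| / |e + u| ^ 2 ≤ κ₀ / (|u| / 3) ^ 2 := div_le_div₀ hκ₀ (hκb _ ha) (by positivity) (pow_le_pow_left₀ (by positivity) hs 2)
      _ = 9 * κ₀ / |u| ^ 2 := by field_simp; norm_num
      _ = 9 * κ₀ / u ^ 2 := by rw [sq_abs]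
  calc |κ' (e / (e - u)) * (e / (e - u) ^ 2) / (e + u) - κ (e / (e - u)) / (e + u) ^ 2|
      ≤ |κ' (e / (e - u)) * (e / (e - u) ^ 2) / (e + u)| + |κ (e / (e - u)) / (e + u) ^ 2| := abs_sub _ _
    _ ≤ 3 * κ₁ / u ^ 2 + 9 * κ₀ / u ^ 2 := add_le_add hT1 hT2
    _ = (3 * κ₁ + 9 * κ₀) / u ^ 2 := by ring

/-- **`|R₋″| ≤ (3κ₂ + 24κ₁ + 54κ₀)/|u|³`** on the far-below region. [folklore] -/
theorem abs_belowR2_le {κ κ' κ'' : ℝ → ℝ} {κ₀ κ₁ κ₂ : ℝ} (hκb : ∀ t ∈ Icc 0 1, |κ t| ≤ κ₀) (hκ'b : ∀ t ∈ Icc 0 1, |κ' t| ≤ κ₁)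
    (hκ''b : ∀ t ∈ Icc 0 1, |κ'' t| ≤ κ₂) {t₁ e u : ℝ} (ht₀ : 0 < t₁) (ht25 : t₁ ≤ 2 / 5) (he : 0 < e) (hu : e * (1 - t₁) / t₁ ≤ -u) :
    |κ'' (e / (e - u)) * (e / (e - u) ^ 2) ^ 2 / (e + u) + κ' (e / (e - u)) * (2 * e / (e - u) ^ 3) / (e + u) -
        2 * (κ' (e / (e - u)) * (e / (e - u) ^ 2)) / (e + u) ^ 2 + 2 * κ (e / (e - u)) / (e + u) ^ 3| ≤
      (3 * κ₂ + 24 * κ₁ + 54 * κ₀) / |u| ^ 3 := by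
  obtain ⟨h1, habs, hmu, hpu, _⟩ := below_geometry ht₀ ht25 he hu
  have hu0 : 0 < |u| := by rw [habs]; linarith
  have hm0 : 0 < e - u := by linarith
  have ha : e / (e - u) ∈ Icc (0 : ℝ) 1 := ⟨div_nonneg he.le hm0.le, (div_le_one hm0).2 (by linarith)⟩
  have hκ₀ : 0 ≤ κ₀ := (abs_nonneg _).trans (hκb _ ha)
  have hκ₁ : 0 ≤ κ₁ := (abs_nonneg _).trans (hκ'b _ ha)
  have hκ₂ : 0 ≤ κ₂ := (abs_nonneg _).trans (hκ''b _ ha)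
  have hs : |u| / 3 ≤ |e + u| := hpu.trans (neg_le_abs _)
  have hs0 : 0 < |e + u| := lt_of_lt_of_le (by positivity) hs
  have ha' : |e / (e - u) ^ 2| ≤ 1 / |u| := by
    rw [abs_div, abs_of_pos he, abs_of_pos (pow_pos hm0 2), div_le_div_iff₀ (pow_pos hm0 2) hu0]
    nlinarith [mul_pos he hu0]
  have ha'' : |2 * e / (e - u) ^ 3| ≤ 2 / |u| ^ 2 := by
    rw [abs_div, abs_of_pos (by positivity : (0 : ℝ) < 2 * e), abs_of_pos (pow_pos hm0 3), div_le_div_iff₀ (pow_pos hm0 3) (by positivity)]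
    have h3 : |u| ^ 2 * |u| ≤ (e - u) ^ 3 := by
      calc |u| ^ 2 * |u| = |u| ^ 3 := by ring
        _ ≤ (e - u) ^ 3 := pow_le_pow_left₀ hu0.le hmu 3
    nlinarith [mul_pos he hu0, pow_pos hu0 2]
  have hT1 : |κ'' (e / (e - u)) * (e / (e - u) ^ 2) ^ 2 / (e + u)| ≤ 3 * κ₂ / |u| ^ 3 := by
    rw [abs_div, abs_mul, abs_pow]
    have hsq : |e / (e - u) ^ 2| ^ 2 ≤ (1 / |u|) ^ 2 := pow_le_pow_left₀ (abs_nonneg _) ha' 2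
    calc |κ'' (e / (e - u))| * |e / (e - u) ^ 2| ^ 2 / |e + u| ≤ κ₂ * (1 / |u|) ^ 2 / (|u| / 3) :=
          div_le_div₀ (by positivity) (mul_le_mul (hκ''b _ ha) hsq (by positivity) hκ₂) (by positivity) hs
      _ = 3 * κ₂ / |u| ^ 3 := by field_simp
  have hT2 : |κ' (e / (e - u)) * (2 * e / (e - u) ^ 3) / (e + u)| ≤ 6 * κ₁ / |u| ^ 3 := by
    rw [abs_div, abs_mul]
    calc |κ' (e / (e - u))| * |2 * e / (e - u) ^ 3| / |e + u| ≤ κ₁ * (2 / |u| ^ 2) / (|u| / 3) :=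
          div_le_div₀ (by positivity) (mul_le_mul (hκ'b _ ha) ha'' (abs_nonneg _) hκ₁) (by positivity) hs
      _ = 6 * κ₁ / |u| ^ 3 := by field_simp; ring
  have hT3 : |2 * (κ' (e / (e - u)) * (e / (e - u) ^ 2)) / (e + u) ^ 2| ≤ 18 * κ₁ / |u| ^ 3 := by
    rw [abs_div, abs_mul, abs_mul, abs_pow, abs_of_pos (by norm_num : (0 : ℝ) < 2)]
    calc 2 * (|κ' (e / (e - u))| * |e / (e - u) ^ 2|) / |e + u| ^ 2 ≤ 2 * (κ₁ * (1 / |u|)) / (|u| / 3) ^ 2 :=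
          div_le_div₀ (by positivity) (mul_le_mul_of_nonneg_left (mul_le_mul (hκ'b _ ha) ha' (abs_nonneg _) hκ₁) (by norm_num)) (by positivity)
            (pow_le_pow_left₀ (by positivity) hs 2)
      _ = 18 * κ₁ / |u| ^ 3 := by field_simp; ring
  have hT4 : |2 * κ (e / (e - u)) / (e + u) ^ 3| ≤ 54 * κ₀ / |u| ^ 3 := by
    rw [abs_div, abs_mul, abs_pow, abs_of_pos (by norm_num : (0 : ℝ) < 2)]
    calc 2 * |κ (e / (e - u))| / |e + u| ^ 3 ≤ 2 * κ₀ / (|u| / 3) ^ 3 :=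
          div_le_div₀ (by positivity) (mul_le_mul_of_nonneg_left (hκb _ ha) (by norm_num)) (by positivity) (pow_le_pow_left₀ (by positivity) hs 3)
      _ = 54 * κ₀ / |u| ^ 3 := by field_simp; ring
  calc |κ'' (e / (e - u)) * (e / (e - u) ^ 2) ^ 2 / (e + u) + κ' (e / (e - u)) * (2 * e / (e - u) ^ 3) / (e + u) -
          2 * (κ' (e / (e - u)) * (e / (e - u) ^ 2)) / (e + u) ^ 2 + 2 * κ (e / (e - u)) / (e + u) ^ 3|
      ≤ |κ'' (e / (e - u)) * (e / (e - u) ^ 2) ^ 2 / (e + u) + κ' (e / (e - u)) * (2 * e / (e - u) ^ 3) / (e + u) -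
          2 * (κ' (e / (e - u)) * (e / (e - u) ^ 2)) / (e + u) ^ 2| + |2 * κ (e / (e - u)) / (e + u) ^ 3| := abs_add_le _ _
    _ ≤ (|κ'' (e / (e - u)) * (e / (e - u) ^ 2) ^ 2 / (e + u) + κ' (e / (e - u)) * (2 * e / (e - u) ^ 3) / (e + u)| +
          |2 * (κ' (e / (e - u)) * (e / (e - u) ^ 2)) / (e + u) ^ 2|) + |2 * κ (e / (e - u)) / (e + u) ^ 3| := by
        gcongr; exact abs_sub _ _
    _ ≤ ((|κ'' (e / (e - u)) * (e / (e - u) ^ 2) ^ 2 / (e + u)| + |κ' (e / (e - u)) * (2 * e / (e - u) ^ 3) / (e + u)|) +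
          |2 * (κ' (e / (e - u)) * (e / (e - u) ^ 2)) / (e + u) ^ 2|) + |2 * κ (e / (e - u)) / (e + u) ^ 3| := by
        gcongr; exact abs_add_le _ _
    _ ≤ ((3 * κ₂ / |u| ^ 3 + 6 * κ₁ / |u| ^ 3) + 18 * κ₁ / |u| ^ 3) + 54 * κ₀ / |u| ^ 3 :=
        add_le_add (add_le_add (add_le_add hT1 hT2) hT3) hT4
    _ = (3 * κ₂ + 24 * κ₁ + 54 * κ₀) / |u| ^ 3 := by ring

/-! ## §2 The below branch `F(u) = N(e,u)·R₋(u)`: identification with the family, two derivatives, sizes -/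

/-- **On the partner-below half line the family is `N·R₋`**: `0 < lo ≤ e`, `u < 0`, `e + u ≠ 0` ⟹ `Kr(e,u) = N(e,u)·κ(e/(e−u))/(e+u)`.
[cite: BenfattoGiulianiMastropietro2006, §2.4 (2.36)] -/
theorem ppFamilyKernel_eq_below {β : ℝ} (hβ : 0 < β) (Λ : ℝ) (κ : ℝ → ℝ) {lo e u : ℝ} (hlo : 0 < lo) (he : lo ≤ e) (hu : u < 0) (hne : e + u ≠ 0) :
    ppFamilyKernel β Λ κ lo e u = ppTrueNumerator β Λ e u * (κ (e / (e - u)) / (e + u)) := by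
  have he0 : 0 < e := hlo.trans_le he
  unfold ppFamilyKernel
  rw [familyScale_eq_abs (by rwa [abs_of_pos he0]), abs_of_pos he0, abs_of_neg hu, ppTrueKernel_eq_div hβ Λ hne, ← sub_eq_add_neg]
  ring

/-- **`∂ᵤF = N′R₋ + NR₋′`** on `e − u ≠ 0`, `e + u ≠ 0`. [cite: BenfattoGiulianiMastropietro2006, §2.4 (2.36)] -/
theorem hasDerivAt_below {β Λ : ℝ} (hβ : 0 < β) (hΛ : 0 < Λ) {B₁ : ℝ} (hB₁ : ∀ x, |deriv salmhoferCutoff x| ≤ B₁) {κ κ' : ℝ → ℝ}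
    (hκ : ∀ t, HasDerivAt κ (κ' t) t) {e u : ℝ} (hm : e - u ≠ 0) (hp : e + u ≠ 0) :
    HasDerivAt (fun v : ℝ => ppTrueNumerator β Λ e v * (κ (e / (e - v)) / (e + v)))
      (ppTrueNumeratorDu β Λ e u * (κ (e / (e - u)) / (e + u)) +
        ppTrueNumerator β Λ e u * (κ' (e / (e - u)) * (e / (e - u) ^ 2) / (e + u) - κ (e / (e - u)) / (e + u) ^ 2)) u :=
  (hasDerivAt_ppTrueNumerator_u hβ hΛ hB₁ e u).mul (hasDerivAt_belowR hκ hm hp)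

/-- **`∂ᵤF′ = N″R₋ + 2N′R₋′ + NR₋″`** on `e − u ≠ 0`, `e + u ≠ 0`. [cite: BenfattoGiulianiMastropietro2006, §2.4 (2.36)] -/
theorem hasDerivAt_below1 {β Λ : ℝ} (hβ : 0 < β) (hΛ : 0 < Λ) {B₁ B₂ : ℝ} (hB₁ : ∀ x, |deriv salmhoferCutoff x| ≤ B₁)
    (hB₂ : ∀ x, |deriv (deriv salmhoferCutoff) x| ≤ B₂) {κ κ' κ'' : ℝ → ℝ} (hκ : ∀ t, HasDerivAt κ (κ' t) t) (hκ' : ∀ t, HasDerivAt κ' (κ'' t) t)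
    {e u : ℝ} (hm : e - u ≠ 0) (hp : e + u ≠ 0) :
    HasDerivAt (fun v : ℝ => ppTrueNumeratorDu β Λ e v * (κ (e / (e - v)) / (e + v)) +
        ppTrueNumerator β Λ e v * (κ' (e / (e - v)) * (e / (e - v) ^ 2) / (e + v) - κ (e / (e - v)) / (e + v) ^ 2))
      (ppTrueNumeratorDuu β Λ e u * (κ (e / (e - u)) / (e + u)) +
        2 * ppTrueNumeratorDu β Λ e u * (κ' (e / (e - u)) * (e / (e - u) ^ 2) / (e + u) - κ (e / (e - u)) / (e + u) ^ 2) +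
        ppTrueNumerator β Λ e u *
          (κ'' (e / (e - u)) * (e / (e - u) ^ 2) ^ 2 / (e + u) + κ' (e / (e - u)) * (2 * e / (e - u) ^ 3) / (e + u) -
            2 * (κ' (e / (e - u)) * (e / (e - u) ^ 2)) / (e + u) ^ 2 + 2 * κ (e / (e - u)) / (e + u) ^ 3)) u := by
  have hN := hasDerivAt_ppTrueNumerator_u hβ hΛ hB₁ e u
  have hN' := hasDerivAt_ppTrueNumeratorDu_u hβ hΛ hB₁ hB₂ e u
  have hR := hasDerivAt_belowR hκ hm hp
  have hR' := hasDerivAt_belowR1 hκ hκ' hm hp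
  have h := (hN'.mul hR).add (hN.mul hR')
  refine h.congr_deriv ?_
  ring

/-- **`|F′| ≤ C₁₋/max(e,|u|)²`** on the far-below region (`e(1−t₁)/t₁ ≤ −u`, `0 < t₁ ≤ 2/5`, `0 < e`), `C₁₋ = 3κ₀(6B₁+9/2) + 3κ₁ + 9κ₀`.
[cite: BenfattoGiulianiMastropietro2006, §2.4 (2.36)] -/
theorem abs_below1_le {β Λ : ℝ} (hβ : 0 < β) (hΛ : 0 < Λ) {B₁ : ℝ} (hB₁ : ∀ x, |deriv salmhoferCutoff x| ≤ B₁) {κ κ' : ℝ → ℝ} {κ₀ κ₁ : ℝ}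
    (hκb : ∀ t ∈ Icc 0 1, |κ t| ≤ κ₀) (hκ'b : ∀ t ∈ Icc 0 1, |κ' t| ≤ κ₁) {t₁ e u : ℝ} (ht₀ : 0 < t₁) (ht25 : t₁ ≤ 2 / 5) (he : 0 < e)
    (hu : e * (1 - t₁) / t₁ ≤ -u) :
    |ppTrueNumeratorDu β Λ e u * (κ (e / (e - u)) / (e + u)) +
        ppTrueNumerator β Λ e u * (κ' (e / (e - u)) * (e / (e - u) ^ 2) / (e + u) - κ (e / (e - u)) / (e + u) ^ 2)| ≤
      (3 * κ₀ * (6 * B₁ + 9 / 2) + 3 * κ₁ + 9 * κ₀) * (max e |u|)⁻¹ ^ 2 := by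
  have hB0 := salmhoferB₁_nonneg hB₁
  obtain ⟨h1, habs, hmu, hpu, hmax⟩ := below_geometry ht₀ ht25 he hu
  have hu0 : 0 < |u| := by rw [habs]; linarith
  have hm0 : 0 < e - u := by linarith
  have ha : e / (e - u) ∈ Icc (0 : ℝ) 1 := ⟨div_nonneg he.le hm0.le, (div_le_one hm0).2 (by linarith)⟩
  have hκ₀ : 0 ≤ κ₀ := (abs_nonneg _).trans (hκb _ ha)
  have hκ₁ : 0 ≤ κ₁ := (abs_nonneg _).trans (hκ'b _ ha)
  have hsupp : 1 * e ≤ |u| := by rw [habs]; linarith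
  have hN := abs_ppTrueNumerator_le_one hβ Λ e u
  have hN' : |ppTrueNumeratorDu β Λ e u| ≤ (6 * B₁ + 9 / 2) / |u| := by
    have h := abs_ppTrueNumeratorDu_le_of_support hβ hΛ hB₁ one_pos le_rfl he hsupp
    rwa [one_mul, hmax] at h
  have hR := abs_belowR_le hκb ht₀ ht25 he hu
  have hR' := abs_belowR1_le hκb hκ'b ht₀ ht25 he hu
  rw [hmax, inv_pow, ← one_div, sq_abs]
  have hA : |ppTrueNumeratorDu β Λ e u * (κ (e / (e - u)) / (e + u))| ≤ 3 * κ₀ * (6 * B₁ + 9 / 2) / u ^ 2 := by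
    rw [abs_mul]
    calc |ppTrueNumeratorDu β Λ e u| * |κ (e / (e - u)) / (e + u)| ≤ (6 * B₁ + 9 / 2) / |u| * (3 * κ₀ / |u|) :=
          mul_le_mul hN' hR (abs_nonneg _) (by positivity)
      _ = 3 * κ₀ * (6 * B₁ + 9 / 2) / |u| ^ 2 := by field_simp
      _ = 3 * κ₀ * (6 * B₁ + 9 / 2) / u ^ 2 := by rw [sq_abs]
  have hB : |ppTrueNumerator β Λ e u * (κ' (e / (e - u)) * (e / (e - u) ^ 2) / (e + u) - κ (e / (e - u)) / (e + u) ^ 2)| ≤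
      (3 * κ₁ + 9 * κ₀) / u ^ 2 := by
    rw [abs_mul]
    calc |ppTrueNumerator β Λ e u| * |κ' (e / (e - u)) * (e / (e - u) ^ 2) / (e + u) - κ (e / (e - u)) / (e + u) ^ 2| ≤ 1 * ((3 * κ₁ + 9 * κ₀) / u ^ 2) :=
          mul_le_mul hN hR' (abs_nonneg _) zero_le_one
      _ = (3 * κ₁ + 9 * κ₀) / u ^ 2 := one_mul _
  calc |ppTrueNumeratorDu β Λ e u * (κ (e / (e - u)) / (e + u)) +
          ppTrueNumerator β Λ e u * (κ' (e / (e - u)) * (e / (e - u) ^ 2) / (e + u) - κ (e / (e - u)) / (e + u) ^ 2)|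
      ≤ 3 * κ₀ * (6 * B₁ + 9 / 2) / u ^ 2 + (3 * κ₁ + 9 * κ₀) / u ^ 2 := (abs_add_le _ _).trans (add_le_add hA hB)
    _ = (3 * κ₀ * (6 * B₁ + 9 / 2) + 3 * κ₁ + 9 * κ₀) * (1 / u ^ 2) := by ring

/-- **`|F″| ≤ C₂₋/max(e,|u|)³`** on the far-below region, `C₂₋ = 3κ₀(16B₂+24B₁+33) + 2(6B₁+9/2)(3κ₁+9κ₀) + 3κ₂+24κ₁+54κ₀`.
[cite: BenfattoGiulianiMastropietro2006, §2.4 (2.36)] -/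
theorem abs_below2_le {β Λ : ℝ} (hβ : 0 < β) (hΛ : 0 < Λ) {B₁ B₂ : ℝ} (hB₁ : ∀ x, |deriv salmhoferCutoff x| ≤ B₁)
    (hB₂ : ∀ x, |deriv (deriv salmhoferCutoff) x| ≤ B₂) {κ κ' κ'' : ℝ → ℝ} {κ₀ κ₁ κ₂ : ℝ} (hκb : ∀ t ∈ Icc 0 1, |κ t| ≤ κ₀)
    (hκ'b : ∀ t ∈ Icc 0 1, |κ' t| ≤ κ₁) (hκ''b : ∀ t ∈ Icc 0 1, |κ'' t| ≤ κ₂) {t₁ e u : ℝ} (ht₀ : 0 < t₁) (ht25 : t₁ ≤ 2 / 5) (he : 0 < e)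
    (hu : e * (1 - t₁) / t₁ ≤ -u) :
    |ppTrueNumeratorDuu β Λ e u * (κ (e / (e - u)) / (e + u)) +
        2 * ppTrueNumeratorDu β Λ e u * (κ' (e / (e - u)) * (e / (e - u) ^ 2) / (e + u) - κ (e / (e - u)) / (e + u) ^ 2) +
        ppTrueNumerator β Λ e u *
          (κ'' (e / (e - u)) * (e / (e - u) ^ 2) ^ 2 / (e + u) + κ' (e / (e - u)) * (2 * e / (e - u) ^ 3) / (e + u) -
            2 * (κ' (e / (e - u)) * (e / (e - u) ^ 2)) / (e + u) ^ 2 + 2 * κ (e / (e - u)) / (e + u) ^ 3)| ≤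
      (3 * κ₀ * (16 * B₂ + 24 * B₁ + 33) + 2 * (6 * B₁ + 9 / 2) * (3 * κ₁ + 9 * κ₀) + (3 * κ₂ + 24 * κ₁ + 54 * κ₀)) * (max e |u|)⁻¹ ^ 3 := by
  have hB0 := salmhoferB₁_nonneg hB₁
  have hB20 : 0 ≤ B₂ := (abs_nonneg _).trans (hB₂ 0)
  obtain ⟨h1, habs, hmu, hpu, hmax⟩ := below_geometry ht₀ ht25 he hu
  have hu0 : 0 < |u| := by rw [habs]; linarith
  have hm0 : 0 < e - u := by linarith
  have ha : e / (e - u) ∈ Icc (0 : ℝ) 1 := ⟨div_nonneg he.le hm0.le, (div_le_one hm0).2 (by linarith)⟩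
  have hκ₀ : 0 ≤ κ₀ := (abs_nonneg _).trans (hκb _ ha)
  have hκ₁ : 0 ≤ κ₁ := (abs_nonneg _).trans (hκ'b _ ha)
  have hκ₂ : 0 ≤ κ₂ := (abs_nonneg _).trans (hκ''b _ ha)
  have hsupp : 1 * e ≤ |u| := by rw [habs]; linarith
  have hN := abs_ppTrueNumerator_le_one hβ Λ e u
  have hN' : |ppTrueNumeratorDu β Λ e u| ≤ (6 * B₁ + 9 / 2) / |u| := by
    have h := abs_ppTrueNumeratorDu_le_of_support hβ hΛ hB₁ one_pos le_rfl he hsupp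
    rwa [one_mul, hmax] at h
  have hN'' : |ppTrueNumeratorDuu β Λ e u| ≤ (16 * B₂ + 24 * B₁ + 33) / u ^ 2 := by
    have h := abs_ppTrueNumeratorDuu_le_of_scale hβ hΛ hB₁ hB₂ (by positivity : 0 < 2 * |u|) le_rfl e
    refine h.trans (le_of_eq ?_)
    rw [mul_pow, sq_abs]; ring
  have hR := abs_belowR_le hκb ht₀ ht25 he hu
  have hR' := abs_belowR1_le hκb hκ'b ht₀ ht25 he hu
  have hR'' := abs_belowR2_le hκb hκ'b hκ''b ht₀ ht25 he hu
  rw [hmax, inv_pow, ← one_div]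
  have hu3 : |u| ^ 3 = |u| * u ^ 2 := by rw [← sq_abs]; ring
  have hA : |ppTrueNumeratorDuu β Λ e u * (κ (e / (e - u)) / (e + u))| ≤ 3 * κ₀ * (16 * B₂ + 24 * B₁ + 33) / |u| ^ 3 := by
    rw [abs_mul]
    calc |ppTrueNumeratorDuu β Λ e u| * |κ (e / (e - u)) / (e + u)| ≤ (16 * B₂ + 24 * B₁ + 33) / u ^ 2 * (3 * κ₀ / |u|) :=
          mul_le_mul hN'' hR (abs_nonneg _) (by positivity)
      _ = 3 * κ₀ * (16 * B₂ + 24 * B₁ + 33) / |u| ^ 3 := by rw [hu3]; field_simp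
  have hB : |2 * ppTrueNumeratorDu β Λ e u * (κ' (e / (e - u)) * (e / (e - u) ^ 2) / (e + u) - κ (e / (e - u)) / (e + u) ^ 2)| ≤
      2 * (6 * B₁ + 9 / 2) * (3 * κ₁ + 9 * κ₀) / |u| ^ 3 := by
    rw [abs_mul, abs_mul, abs_of_pos (by norm_num : (0 : ℝ) < 2)]
    calc 2 * |ppTrueNumeratorDu β Λ e u| * |κ' (e / (e - u)) * (e / (e - u) ^ 2) / (e + u) - κ (e / (e - u)) / (e + u) ^ 2|
        ≤ 2 * ((6 * B₁ + 9 / 2) / |u|) * ((3 * κ₁ + 9 * κ₀) / u ^ 2) := by gcongr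
      _ = 2 * (6 * B₁ + 9 / 2) * (3 * κ₁ + 9 * κ₀) / |u| ^ 3 := by rw [hu3]; field_simp
  have hC : |ppTrueNumerator β Λ e u *
        (κ'' (e / (e - u)) * (e / (e - u) ^ 2) ^ 2 / (e + u) + κ' (e / (e - u)) * (2 * e / (e - u) ^ 3) / (e + u) -
          2 * (κ' (e / (e - u)) * (e / (e - u) ^ 2)) / (e + u) ^ 2 + 2 * κ (e / (e - u)) / (e + u) ^ 3)| ≤
      (3 * κ₂ + 24 * κ₁ + 54 * κ₀) / |u| ^ 3 := by
    rw [abs_mul]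
    calc _ ≤ 1 * ((3 * κ₂ + 24 * κ₁ + 54 * κ₀) / |u| ^ 3) := mul_le_mul hN hR'' (abs_nonneg _) zero_le_one
      _ = _ := one_mul _
  calc _ ≤ |ppTrueNumeratorDuu β Λ e u * (κ (e / (e - u)) / (e + u)) +
          2 * ppTrueNumeratorDu β Λ e u * (κ' (e / (e - u)) * (e / (e - u) ^ 2) / (e + u) - κ (e / (e - u)) / (e + u) ^ 2)| +
        |ppTrueNumerator β Λ e u *
          (κ'' (e / (e - u)) * (e / (e - u) ^ 2) ^ 2 / (e + u) + κ' (e / (e - u)) * (2 * e / (e - u) ^ 3) / (e + u) -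
            2 * (κ' (e / (e - u)) * (e / (e - u) ^ 2)) / (e + u) ^ 2 + 2 * κ (e / (e - u)) / (e + u) ^ 3)| := abs_add_le _ _
    _ ≤ (3 * κ₀ * (16 * B₂ + 24 * B₁ + 33) / |u| ^ 3 + 2 * (6 * B₁ + 9 / 2) * (3 * κ₁ + 9 * κ₀) / |u| ^ 3) + (3 * κ₂ + 24 * κ₁ + 54 * κ₀) / |u| ^ 3 :=
        add_le_add ((abs_add_le _ _).trans (add_le_add hA hB)) hC
    _ = (3 * κ₀ * (16 * B₂ + 24 * B₁ + 33) + 2 * (6 * B₁ + 9 / 2) * (3 * κ₁ + 9 * κ₀) + (3 * κ₂ + 24 * κ₁ + 54 * κ₀)) * (1 / |u| ^ 3) := by ring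

end Summit.HubbardSuperconductivity.HubbardSuperconductivity.Theorems.C4a

end
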